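import Literature.NumberTheory.Sieve.LargestPrimeFactorCubicCubeCover
import HarnessLib

/-!
# Heath-Brown 2001 (PLMS), §8 with cubes of side `M = X^{(1+δ)/3}`: the covering and the Riemann-sum
# bound with the RELATIVE perturbation `|N(y) − N(x)| ≤ (η/4) N(x)`

Topic `Literature/NumberTheory/Sieve`; a PROVED layer (one definition with body, no named facts) under
the named fact `Irving2015_largestPrimeFactor_cubic` (`LargestPrimeFactorCubic.lean`), the form of
`…GoodCubes.inBox_of_supClose` / `…CubeCover.genVolume_shrunk_le` needed for Heath-Brown's own cube
size.  Source: D. R. Heath-Brown, *The largest prime factor of `X³ + 2`*, Proc. London Math. Soc. (3) 82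
(2001) 554–596, §8 pp. 30–34: the cubes `𝓑` have side `M = X^{(1+δ)/3}` ((2.6)), and the perturbation of
`N` across a cube is measured RELATIVELY: (8.4) "`N(x) = N(x₀) + O(M N(x₀)^{2/3})` … Since `N(x₀) ≫
M³X^{δ/2}` it follows that `N(x) ≫ N(x₀)` for all `x ∈ 𝓑`", the relative error being `M N^{−1/3} ≤
X^{−δ/6}` ((8.10): "`μ = X^{1+2δ} + O(X^{1+5δ/3})`").  The absolute condition `1404 N₂^{2/3} m ≤ ηN₁/4` of
`…GoodCubes` fails for such large cubes; here it is replaced by the relative estimate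
`1404 N(x)^{2/3} m ≤ (η/4) N(x)`, a consequence of `6000 m ≤ η N₁^{1/3}` alone:

* `inBox_of_supClose_rel` — the covering statement without that condition;
* `NplusRel η m k = N(corner)(1 + η/4)`, `exists_good_cube_rel`, `inv_normForm_le_rel`
  (`1/N(y) ≤ (1 + η)/N⁺_k` on a good cube), **`genVolume_shrunk_le_rel`**:
  `I(𝓢_η) ≤ (1 + η) ∑_{k good} m³/N⁺_k`.

## References

* D. R. Heath-Brown, *The largest prime factor of `X³ + 2`*, Proc. London Math. Soc. (3) 82 (2001)
  554–596, §8 pp. 30–34 ((8.4), (8.10)), (2.6) p. 6. [`HeathBrown2001LargestPrimeFactorCubic`]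

## Mathlib / tree search

Tree: everything of `…GoodCubes`, `…CubeSum`, `…CubeCover` (`InBox`, `InShrunk`, `SupClose`,
`window_bounds`, `abs_normForm_sub_le_of_supClose`, `abs_cbrt_sub_le`, `abs_ell_sub_le_of_supClose`,
`abs_lin_sub_le_of_supClose`, `cubic_factor`, `fst_sub_rho_mul_eq`, `sqrt3_re_sub_im_eq`,
`sin_le_cos_arg_add`, `half_le_sin`, `gridCube`, `gridIdx`, `goodSet`, `GoodIdx`, `corner`,
`corner_mem_gridCube`, `coords_pos_of_window`, `integral_indicator_le_sum_cubes`, `genVolume`),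
`rpow_third_pow_three`.
-/

noncomputable section

open Finset Real MeasureTheory

namespace Literature.NumberTheory.Sieve.HeathBrown2001

open CubicSieve

/-- `N⁺_k = N(corner)(1 + η/4)` (relative form). [cite: HeathBrown2001LargestPrimeFactorCubic, §8 (8.4)] -/
def NplusRel (η m : ℝ) (k : ℕ × ℕ × ℕ) : ℝ := normForm (corner m k) * (1 + η / 4)

set_option maxHeartbeats 1600000 in
/-- **Good cubes cover the shrunk box (relative form)**: as `inBox_of_supClose`, WITHOUT the condition
`1404 N₂^{2/3} m ≤ ηN₁/4`: the perturbation `|N(y) − N(x)| ≤ 1404 N(x)^{2/3} m ≤ (η/4) N(x)` is measured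
against `N(x)` itself ((8.4), relative error `M N^{−1/3} ≤ X^{−δ/6}` for cubes of side `M = X^{(1+δ)/3}`), so
`6000 m ≤ ηN₁^{1/3}` and `M₃ ≤ ηN₁/5000` suffice.
[cite: HeathBrown2001LargestPrimeFactorCubic, §8 (8.4) and pp. 33–34 ((8.10)–(8.14))] -/
theorem inBox_of_supClose_rel {N₁ N₂ M₃ η m : ℝ} (hN₁ : 0 < N₁) (hN : N₁ ≤ N₂) (hη : 0 < η) (hη1 : η ≤ 1 / 2)
    (hm : 0 < m)
    (C2 : 6000 * m ≤ η * N₁ ^ ((1 : ℝ) / 3))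
    (C3 : M₃ ≤ η * N₁ / 5000)
    {x y : ℝ × ℝ × ℝ} (hx : InShrunk η N₁ N₂ x) (hxy : SupClose m x y) : InBox N₁ N₂ M₃ y := by
  obtain ⟨hxN1, hxN2, hw1, hw2, harg⟩ := hx
  have hE1 := one_lt_unitE
  have hE4 := unitE_lt_four
  have hE0 : (0 : ℝ) < unitE := by linarith
  have hπ3 := Real.pi_gt_three
  -- scales (rewrite `N₂^{2/3} = (N₂^{1/3})²` before abbreviating)
  have hN₂ : 0 < N₂ := hN₁.trans_le hN
  set t := N₁ ^ ((1 : ℝ) / 3) with htdef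
  set T := N₂ ^ ((1 : ℝ) / 3) with hTdef
  have ht0 : 0 < t := Real.rpow_pos_of_pos hN₁ _
  have hT0 : 0 < T := Real.rpow_pos_of_pos hN₂ _
  have hηN₁ : 0 < η * N₁ := mul_pos hη hN₁
  -- the norm of `x` and `c = N(x)^{1/3}`
  have e1 : N₁ * (1 + η) = N₁ + η * N₁ := by ring
  have e2 : N₂ * (1 - η) = N₂ - η * N₂ := by ring
  have hηN : η * N₁ ≤ η * N₂ := mul_le_mul_of_nonneg_left hN hη.le
  have hNx : 0 < normForm x := by linarith
  have hN₁x : N₁ ≤ normForm x := by linarith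
  have hxN₂ : normForm x ≤ N₂ := by
    have : 0 ≤ η * N₂ := by positivity
    linarith
  set c := (normForm x) ^ ((1 : ℝ) / 3) with hcdef
  have hc0 : 0 < c := Real.rpow_pos_of_pos hNx _
  have hc3 : c ^ 3 = normForm x := rpow_third_pow_three hNx.le
  have htc : t ≤ c := by
    rw [htdef, hcdef]; exact Real.rpow_le_rpow hN₁.le hN₁x (by norm_num)
  have hcT : c ≤ T := by
    rw [hTdef, hcdef]; exact Real.rpow_le_rpow hNx.le hxN₂ (by norm_num)
  have hηc0 : 0 ≤ η * c := by positivity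
  -- `x` lies in the (unshrunk) window
  have e3 : 2 * (1 + η) * c = 2 * c + 2 * (η * c) := by ring
  have e4 : 2 * unitE * (1 - η) * c = 2 * unitE * c - 2 * (unitE * (η * c)) := by ring
  have hEηc0 : 0 ≤ unitE * (η * c) := by positivity
  have hw1' : 2 * c < ell x := by linarith
  have hw2' : ell x < 2 * unitE * c := by linarith
  obtain ⟨hcoord, hQlt, hQgt, hx1⟩ := window_bounds hNx hw1' hw2'
  -- `m` is small
  have hηt : η * t ≤ 1 / 2 * t := mul_le_mul_of_nonneg_right hη1 ht0.le
  have hmt : 6000 * m ≤ t / 2 := by linarith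
  have hmc : m ≤ c := by linarith
  have hηc : 6000 * m ≤ η * c := C2.trans (mul_le_mul_of_nonneg_left htc hη.le)
  -- the perturbation of `N`
  have hΔ := abs_normForm_sub_le_of_supClose hm.le hmc hcoord hxy
  -- RELATIVE size of the perturbation: `1404 c² m ≤ (η/4) c³ = (η/4) N(x)`
  have hΔ' : 1404 * c ^ 2 * m ≤ η / 4 * normForm x := by
    rw [← hc3]
    have h1 : 1404 * m ≤ η * c / 4 := by linarith
    have := mul_le_mul_of_nonneg_left h1 (le_of_lt (pow_pos hc0 2))
    nlinarith
  obtain ⟨hΔ1, hΔ2⟩ := abs_le.mp hΔ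
  have hη14 : (1 : ℝ) ≤ (1 + η) * (1 - η / 4) := by nlinarith
  have hη14' : (1 - η) * (1 + η / 4) ≤ 1 := by nlinarith
  have hyN1 : N₁ < normForm y := by
    have h1 : N₁ * ((1 + η) * (1 - η / 4)) < normForm x * (1 - η / 4) := by
      have : 0 < 1 - η / 4 := by linarith
      nlinarith
    have h2 : N₁ ≤ N₁ * ((1 + η) * (1 - η / 4)) := le_mul_of_one_le_right hN₁.le hη14
    nlinarith
  have hyN2 : normForm y < N₂ := by
    have h1 : normForm x * (1 + η / 4) < N₂ * ((1 - η) * (1 + η / 4)) := by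
      have : 0 < 1 + η / 4 := by linarith
      nlinarith
    have h2 : N₂ * ((1 - η) * (1 + η / 4)) ≤ N₂ := mul_le_of_le_one_right hN₂.le hη14'
    nlinarith
  have hNy : 0 < normForm y := hN₁.trans hyN1
  -- the cube root of `N(y)`
  set c' := (normForm y) ^ ((1 : ℝ) / 3) with hc'def
  have hcc' : |c' - c| ≤ 1404 * m := by
    refine abs_cbrt_sub_le hc0 hNy.le (by positivity) ?_
    rw [hc3]
    calc |normForm y - normForm x| ≤ 1404 * c ^ 2 * m := hΔ
      _ = 1404 * m * c ^ 2 := by ring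
  obtain ⟨hcc1, hcc2⟩ := abs_le.mp hcc'
  -- the window for `y`
  obtain ⟨hell1, hell2⟩ := abs_le.mp (abs_ell_sub_le_of_supClose hxy)
  have hwy1 : 2 * c' < ell y := by linarith
  have hEm : unitE * m ≤ 4 * m := mul_le_mul_of_nonneg_right hE4.le hm.le
  have hEηc : η * c ≤ unitE * (η * c) := le_mul_of_one_le_left hηc0 hE1.le
  have hEc' : 2 * unitE * (c - 1404 * m) ≤ 2 * unitE * c' :=
    mul_le_mul_of_nonneg_left (by linarith) (by positivity)
  have e5 : 2 * unitE * (c - 1404 * m) = 2 * unitE * c - 2808 * (unitE * m) := by ring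
  have hwy2 : ell y < 2 * unitE * c' := by linarith
  -- the cubic condition for `y`
  obtain ⟨hfac, hquad⟩ := cubic_factor y.1 y.2.1
  obtain ⟨hlin1, -⟩ := abs_le.mp (abs_lin_sub_le_of_supClose hxy)
  have h3pos : 0 < Real.sqrt 3 := Real.sqrt_pos.mpr (by norm_num)
  have hs3 : Real.sqrt 3 ^ 2 = 3 := Real.sq_sqrt (by norm_num)
  have hs3lt : Real.sqrt 3 ≤ 2 := by
    rw [show (2 : ℝ) = Real.sqrt 4 by rw [show (4:ℝ) = 2 ^ 2 by norm_num, Real.sqrt_sq (by norm_num)]]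
    exact Real.sqrt_le_sqrt (by norm_num)
  have hv2 : ‖cplxEmb x‖ ^ 2 = Complex.normSq (cplxEmb x) := (Complex.normSq_eq_norm_sq _).symm
  have hc2 : 0 < c ^ 2 := by positivity
  have hvpos : c / 3 ≤ ‖cplxEmb x‖ := by
    by_contra hlt
    push Not at hlt
    have h1 : ‖cplxEmb x‖ ^ 2 ≤ (c / 3) ^ 2 := pow_le_pow_left₀ (norm_nonneg _) hlt.le 2
    have h2 : (c / 3) ^ 2 = c ^ 2 / 9 := by ring
    linarith
  have hηπ : η ≤ Real.pi / 2 := by linarith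
  have hcos := sin_le_cos_arg_add hη.le harg
  have hsin := half_le_sin hη.le hηπ
  have hcos' : η / 2 ≤ Real.cos (Complex.arg (cplxEmb x) + Real.pi / 6) := hsin.trans hcos
  have hlinx : η * c / 12 ≤ x.1 - rho * x.2.1 := by
    rw [fst_sub_rho_mul_eq, sqrt3_re_sub_im_eq, le_div_iff₀ h3pos]
    have hprod : c / 3 * (η / 2) ≤ ‖cplxEmb x‖ * Real.cos (Complex.arg (cplxEmb x) + Real.pi / 6) :=
      mul_le_mul hvpos hcos' (by positivity) (norm_nonneg _)
    have hleft : η * c / 12 * Real.sqrt 3 ≤ η * c / 12 * 2 := mul_le_mul_of_nonneg_left hs3lt (by positivity)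
    have e6 : c / 3 * (η / 2) = η * c / 6 := by ring
    linarith
  have hliny : η * c / 24 ≤ y.1 - rho * y.2.1 := by linarith
  have hy1 : c / 12 ≤ y.1 := by
    obtain ⟨hd1, -, -⟩ := hxy
    have := (abs_le.mp hd1).1
    linarith
  have hquad' : 3 / 4 * (c / 12) ^ 2 ≤ y.1 ^ 2 + rho * y.1 * y.2.1 + rho ^ 2 * y.2.1 ^ 2 := by
    have : (c / 12) ^ 2 ≤ y.1 ^ 2 := pow_le_pow_left₀ (by positivity) hy1 2
    linarith
  have hcubic : M₃ < y.1 ^ 3 - 2 * y.2.1 ^ 3 := by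
    rw [hfac]
    have h1 : η * c / 24 * (3 / 4 * (c / 12) ^ 2) ≤
        (y.1 - rho * y.2.1) * (y.1 ^ 2 + rho * y.1 * y.2.1 + rho ^ 2 * y.2.1 ^ 2) :=
      mul_le_mul hliny hquad' (by positivity) (le_trans (by positivity) hliny)
    have h2 : η * c / 24 * (3 / 4 * (c / 12) ^ 2) = η * c ^ 3 / 4608 := by ring
    have h3 : η * N₁ ≤ η * c ^ 3 := by rw [hc3]; exact mul_le_mul_of_nonneg_left hN₁x hη.le
    have h4 : M₃ < η * N₁ / 4608 := by linarith
    linarith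
  exact ⟨hyN1, hyN2, hwy1, hwy2, hcubic⟩


/-- **Covering** (relative form): under `6000 m ≤ ηN₁^{1/3}`, `M₃ ≤ ηN₁/5000` and `6N₂^{1/3} ≤ Km`,
every `x ∈ 𝓢_η` lies in `gridCube m k` for a good index `k ∈ goodSet`.
[cite: HeathBrown2001LargestPrimeFactorCubic, §8 pp. 33–34] -/
theorem exists_good_cube_rel {N₁ N₂ M₃ η m : ℝ} {K : ℕ} (hN₁ : 0 < N₁) (hN : N₁ ≤ N₂) (hη : 0 < η)
    (hη1 : η ≤ 1 / 2) (hm : 0 < m)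
    (C2 : 6000 * m ≤ η * N₁ ^ ((1 : ℝ) / 3))
    (C3 : M₃ ≤ η * N₁ / 5000) (hK : 6 * N₂ ^ ((1 : ℝ) / 3) ≤ K * m)
    {x : ℝ × ℝ × ℝ} (hx : InShrunk η N₁ N₂ x) :
    ∃ k ∈ goodSet N₁ N₂ M₃ m K, x ∈ gridCube m (k) := by
  classical
  -- `x` itself is in `InBox` (take `y = x`), hence in the window, hence has small positive coordinates
  have hxx : SupClose m x x := by
    refine ⟨?_, ?_, ?_⟩ <;> simp [hm.le]
  obtain ⟨hxN1, hxN2, hw1, hw2, -⟩ := inBox_of_supClose_rel hN₁ hN hη hη1 hm C2 C3 hx hxx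
  have hNx : 0 < normForm x := hN₁.trans hxN1
  obtain ⟨hcoord, -, -, -⟩ := window_bounds hNx hw1 hw2
  obtain ⟨hp1, hp2, hp3⟩ := coords_pos_of_window hNx hw1 hw2
  have hN₂ : 0 < N₂ := hN₁.trans_le hN
  have hcT : (normForm x) ^ ((1 : ℝ) / 3) ≤ N₂ ^ ((1 : ℝ) / 3) :=
    Real.rpow_le_rpow hNx.le hxN2.le (by norm_num)
  have hlt : ∀ t : ℝ, |t| ≤ 5 * (normForm x) ^ ((1 : ℝ) / 3) → t < K * m := by
    intro t ht
    have := (abs_le.mp ht).2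
    have h0 : 0 < N₂ ^ ((1 : ℝ) / 3) := Real.rpow_pos_of_pos hN₂ _
    linarith
  refine ⟨gridIdx m x, ?_, mem_gridCube_gridIdx hm ⟨hp1.le, hp2.le, hp3.le⟩⟩
  rw [goodSet, Finset.mem_filter]
  refine ⟨gridIdx_mem hm ⟨hp1.le, hp2.le, hp3.le⟩ ⟨hlt _ hcoord.1, hlt _ hcoord.2.1, hlt _ hcoord.2.2⟩, ?_⟩
  intro y hy
  have hxy : SupClose m x y := abs_sub_le_of_mem_gridCube (mem_gridCube_gridIdx hm ⟨hp1.le, hp2.le, hp3.le⟩) hy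
  exact inBox_of_supClose_rel hN₁ hN hη hη1 hm C2 C3 hx hxy

/-! ### The weights on a good cube -/

/-- **On a good cube** `k` (relative form): with `N⁺_k = N(corner)(1 + η/4)`, `N(y) ≤ N⁺_k` and
`1/N(y) ≤ (1 + η)/N⁺_k` for all `y` in the cube (`|N(y) − N(corner)| ≤ (η/4) N(corner)` by (8.4)).
[cite: HeathBrown2001LargestPrimeFactorCubic, §8 (8.4) and p. 33 ("∫_𝓑 |N⁻¹ − N_𝓑⁻¹| ≪ …")] -/
theorem inv_normForm_le_rel {N₁ N₂ M₃ η m : ℝ} (hN₁ : 0 < N₁) (hN : N₁ ≤ N₂) (hη : 0 < η) (hη1 : η ≤ 1 / 2)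
    (hm : 0 < m)
    (C2 : 6000 * m ≤ η * N₁ ^ ((1 : ℝ) / 3))
    {k : ℕ × ℕ × ℕ} (hk : GoodIdx N₁ N₂ M₃ m k) {y : ℝ × ℝ × ℝ} (hy : y ∈ gridCube m k) :
    0 < NplusRel η m k ∧ normForm y ≤ NplusRel η m k ∧
      (normForm y)⁻¹ ≤ (1 + η) / NplusRel η m k := by
  set z := corner m k with hz
  have hzmem : z ∈ gridCube m k := corner_mem_gridCube hm.le k
  obtain ⟨hzN1, hzN2, hzw1, hzw2, -⟩ := hk z hzmem
  obtain ⟨hyN1, -, -, -, -⟩ := hk y hy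
  have hN₂ : 0 < N₂ := hN₁.trans_le hN
  have hNz : 0 < normForm z := hN₁.trans hzN1
  obtain ⟨hcoord, -, -, -⟩ := window_bounds hNz hzw1 hzw2
  -- `m ≤ c_z`
  have hcz0 : 0 < (normForm z) ^ ((1 : ℝ) / 3) := Real.rpow_pos_of_pos hNz _
  have htcz : N₁ ^ ((1 : ℝ) / 3) ≤ (normForm z) ^ ((1 : ℝ) / 3) :=
    Real.rpow_le_rpow hN₁.le hzN1.le (by norm_num)
  have ht0 : 0 < N₁ ^ ((1 : ℝ) / 3) := Real.rpow_pos_of_pos hN₁ _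
  have hmcz : m ≤ (normForm z) ^ ((1 : ℝ) / 3) := by
    have : η * N₁ ^ ((1 : ℝ) / 3) ≤ 1 / 2 * N₁ ^ ((1 : ℝ) / 3) := mul_le_mul_of_nonneg_right hη1 ht0.le
    linarith
  have hΔ := abs_normForm_sub_le_of_supClose hm.le hmcz hcoord (abs_sub_le_of_mem_gridCube hzmem hy)
  -- relative size: `1404 c_z² m ≤ (η/4) N(z)`
  have hcz3 : ((normForm z) ^ ((1 : ℝ) / 3)) ^ 3 = normForm z := rpow_third_pow_three hNz.le
  have hηcz : 6000 * m ≤ η * (normForm z) ^ ((1 : ℝ) / 3) := C2.trans (mul_le_mul_of_nonneg_left htcz hη.le)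
  have hΔ' : 1404 * ((normForm z) ^ ((1 : ℝ) / 3)) ^ 2 * m ≤ η / 4 * normForm z := by
    have h1 : 1404 * m ≤ η * (normForm z) ^ ((1 : ℝ) / 3) / 4 := by linarith
    calc 1404 * ((normForm z) ^ ((1 : ℝ) / 3)) ^ 2 * m = ((normForm z) ^ ((1 : ℝ) / 3)) ^ 2 * (1404 * m) := by ring
      _ ≤ ((normForm z) ^ ((1 : ℝ) / 3)) ^ 2 * (η * (normForm z) ^ ((1 : ℝ) / 3) / 4) :=
          mul_le_mul_of_nonneg_left h1 (le_of_lt (pow_pos hcz0 2))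
      _ = η / 4 * ((normForm z) ^ ((1 : ℝ) / 3)) ^ 3 := by ring
      _ = η / 4 * normForm z := by rw [hcz3]
  obtain ⟨hΔ1, hΔ2⟩ := abs_le.mp hΔ
  have hplus : normForm y ≤ NplusRel η m k := by
    unfold NplusRel; rw [← hz]; nlinarith
  have hpos : 0 < NplusRel η m k := by unfold NplusRel; rw [← hz]; positivity
  refine ⟨hpos, hplus, ?_⟩
  have hNy : 0 < normForm y := hN₁.trans hyN1
  rw [inv_eq_one_div, div_le_div_iff₀ hNy hpos, one_mul]
  unfold NplusRel; rw [← hz]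
  -- `N(z)(1 + η/4) ≤ (1 + η) N(y)` since `N(y) ≥ N(z)(1 − η/4)` and `(1+η/4) ≤ (1+η)(1−η/4)`
  have hy_ge : normForm z * (1 - η / 4) ≤ normForm y := by nlinarith
  have hcoef : (1 + η / 4) ≤ (1 + η) * (1 - η / 4) := by nlinarith
  nlinarith [mul_le_mul_of_nonneg_left hcoef hNz.le, mul_le_mul_of_nonneg_left hy_ge (by linarith : (0:ℝ) ≤ 1 + η)]

/-! ### The integral inequality -/

/-- **`I(𝓢_η) ≤ (1 + η) ∑_{k good} m³/N⁺_k`** (relative form, `N⁺_k = N(corner)(1 + η/4)`), under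
`6000 m ≤ ηN₁^{1/3}`, `M₃ ≤ ηN₁/5000` and `6N₂^{1/3} ≤ Km` only.
[cite: HeathBrown2001LargestPrimeFactorCubic, §8 pp. 30–34 (I₁, (8.3)–(8.7), (8.10)–(8.14))] -/
theorem genVolume_shrunk_le_rel {N₁ N₂ M₃ η m : ℝ} {K : ℕ} (hN₁ : 0 < N₁) (hN : N₁ ≤ N₂) (hη : 0 < η)
    (hη1 : η ≤ 1 / 2) (hm : 0 < m)
    (C2 : 6000 * m ≤ η * N₁ ^ ((1 : ℝ) / 3))
    (C3 : M₃ ≤ η * N₁ / 5000) (hK : 6 * N₂ ^ ((1 : ℝ) / 3) ≤ K * m) :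
    genVolume (2 * (1 + η)) (2 * unitE * (1 - η)) (-(2 * Real.pi / 3) + η) (Real.pi / 3 - η)
        (N₁ * (1 + η)) (N₂ * (1 - η)) ≤
      (1 + η) * ∑ k ∈ goodSet N₁ N₂ M₃ m K, m ^ 3 / NplusRel η m k := by
  classical
  -- the integral is `∫ 𝟙_S F` with `S = {InShrunk}`, `F = 1/N`
  set S : Set (ℝ × ℝ × ℝ) := {x | InShrunk η N₁ N₂ x} with hS
  have hvol : genVolume (2 * (1 + η)) (2 * unitE * (1 - η)) (-(2 * Real.pi / 3) + η) (Real.pi / 3 - η)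
      (N₁ * (1 + η)) (N₂ * (1 - η)) = ∫ x, S.indicator (fun x => (normForm x)⁻¹) x := by
    rfl
  rw [hvol]
  have h := integral_indicator_le_sum_cubes (S := S) (F := fun x => (normForm x)⁻¹) hm
    (goodSet N₁ N₂ M₃ m K) (fun k => (1 + η) / NplusRel η m k) ?_ ?_ ?_ ?_
  · refine h.trans (le_of_eq ?_)
    rw [Finset.mul_sum]
    exact Finset.sum_congr rfl fun k _ => by ring
  · intro k hk
    rw [goodSet, Finset.mem_filter] at hk
    have := (inv_normForm_le_rel hN₁ hN hη hη1 hm C2 hk.2 (corner_mem_gridCube hm.le k)).1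
    positivity
  · intro x hx
    exact exists_good_cube_rel hN₁ hN hη hη1 hm C2 C3 hK hx
  · intro k hk y hy
    rw [goodSet, Finset.mem_filter] at hk
    exact (inv_normForm_le_rel hN₁ hN hη hη1 hm C2 hk.2 hy).2.2
  · intro x hx
    obtain ⟨h1, -⟩ := (hx : InShrunk η N₁ N₂ x)
    have : 0 < normForm x := by
      have : 0 < N₁ * (1 + η) := by positivity
      linarith
    positivity


end Literature.NumberTheory.Sieve.HeathBrown2001
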